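import Mathlib
import HarnessLib
import Summits.NavierStokesRegularity.NavierStokesRegularity.Theorems.TaylorModelRungThreeSoundnessVectorDeriv
import Summits.NavierStokesRegularity.NavierStokesRegularity.Theorems.TaylorModelRungThreeSoundnessVectorHigh

/-!
# Line `taylor-model` on crux K1b-DR (`ExactWindowRungThree.DerivativeEnclosureCertificateR`,
# stmt-NavierStokesRegularity-23954) — VECTOR STEP LEMMA, part 7: the segment derivative of the selector under
# the HIGH-ORDER tests

(F4)-shape supplier (K1b-DR's LIP clause: derivative of the flow along segments of initial states) for LONG
sub-steps certified by the high-order rough-enclosure tests of part 5 (the first-order variant is part 4's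
`hasDerivWithinAt_flowSel_initial`).  `Fin n` / S1 vocabulary (`IsMajorantSystem`, `flowSel`).

* `hasDerivWithinAt_flowSel_initial_of_highOrderEnclosure` — if every state `x + θ • v` (`θ ∈ [0,1]`) passes the
  strict order-`p` test for the box `[lo,hi]` on `[0,h]` (jets `T (x + θ • v) k`, enclosure `J` of order `p+1` over
  the box), and at `θ₀` the variation `v` passes the strict order-`p` test for `[loV,hiV]` (jets `U (x + θ₀ • v) v k`,
  enclosure `JV` over the product box), then there is a variational solution `V` along `flowSel Q (x + θ₀ • v)` with
  `V 0 = v`, confined to `[loV,hiV]`, and `θ ↦ flowSel Q (x + θ • v) t` has derivative `V t` within `[0,1]` at `θ₀`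
  for every `t ∈ [0,h]` — by part 4's `hasDerivWithinAt_flow_initial` (two Grönwall estimates, no step restriction).

MODEL-lattice bookkeeping only (rung TL-M3 of the NS ladder: one finite-dimensional model ODE); nothing
here is a statement about the Navier–Stokes equations.
-/

noncomputable section

-- the sub-problem namespace repeats the summit name by design (D-0017)
set_option linter.dupNamespace false

namespace Summit.NavierStokesRegularity.NavierStokesRegularity.Theorems.TaylorModelVector

open scoped BigOperators Topology
open Set Filter
open Summit.NavierStokesRegularity.NavierStokesRegularity.Theorems.TaylorModelMajorant

variable {n : ℕ} {Q : (Fin n → ℝ) → (Fin n → ℝ) → Fin n → ℝ} {w : Fin n → ℝ} {b : ℝ}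
  {T : (Fin n → ℝ) → ℕ → Fin n → ℝ} {U : (Fin n → ℝ) → (Fin n → ℝ) → ℕ → Fin n → ℝ}

/-- **Segment derivative of the selector under the high-order tests** ((F4)-shape, no step restriction): see the
module docstring. [folklore] -/
theorem hasDerivWithinAt_flowSel_initial_of_highOrderEnclosure (hS : IsMajorantSystem n Q w b T U)
    {lo hi loV hiV x v : Fin n → ℝ} {h : ℝ} (hh : 0 ≤ h) {p : ℕ} {J JV : Fin n → ℝ}
    (hJ : ∀ y ∈ Icc lo hi, ∀ c, |T y (p + 1) c| ≤ J c)
    (hJV : ∀ y ∈ Icc lo hi, ∀ d ∈ Icc loV hiV, ∀ c, |U y d (p + 1) c| ≤ JV c)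
    (htest : ∀ θ ∈ Icc (0:ℝ) 1, ∀ u ∈ Icc (0:ℝ) h, ∀ c,
      lo c < ∑ k ∈ Finset.range (p + 1), T (x + θ • v) k c * u ^ k - J c * u ^ (p + 1) ∧
      ∑ k ∈ Finset.range (p + 1), T (x + θ • v) k c * u ^ k + J c * u ^ (p + 1) < hi c)
    {θ₀ : ℝ} (hθ₀ : θ₀ ∈ Icc (0:ℝ) 1)
    (htestV : ∀ u ∈ Icc (0:ℝ) h, ∀ c,
      loV c < ∑ k ∈ Finset.range (p + 1), U (x + θ₀ • v) v k c * u ^ k - JV c * u ^ (p + 1) ∧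
      ∑ k ∈ Finset.range (p + 1), U (x + θ₀ • v) v k c * u ^ k + JV c * u ^ (p + 1) < hiV c)
    {t : ℝ} (ht : t ∈ Icc 0 h) :
    ∃ V : ℝ → Fin n → ℝ, V 0 = v ∧
      (∀ s ∈ Icc 0 h, HasDerivWithinAt V
        (Q (flowSel Q (x + θ₀ • v) s) (V s) + Q (V s) (flowSel Q (x + θ₀ • v) s)) (Icc 0 h) s) ∧
      (∀ s ∈ Icc 0 h, V s ∈ Icc loV hiV) ∧
      HasDerivWithinAt (fun θ => flowSel Q (x + θ • v) t) (V t) (Icc 0 1) θ₀ := by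
  obtain ⟨Qb, hQb⟩ := exists_bundle hS
  have hTs : ∀ x (k : ℕ) c, ((k : ℝ) + 1) * T x (k + 1) c =
      ∑ i ∈ Finset.range (k + 1), Qb (T x i) (T x (k - i)) c := by
    simpa only [hQb] using hS.T_succ
  have hUs : ∀ x v (k : ℕ) c, ((k : ℝ) + 1) * U x v (k + 1) c =
      ∑ i ∈ Finset.range (k + 1), (Qb (T x i) (U x v (k - i)) c + Qb (U x v (k - i)) (T x i) c) := by
    simpa only [hQb] using hS.U_succ
  obtain ⟨ψ₀, V, hψ00, hV0, hψ0der, hVder, -, hVbox⟩ :=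
    exists_pair_sol_mem_Icc_of_highOrderEnclosure Qb hS.T_zero hTs hS.U_zero hUs hh hJ hJV
      (htest θ₀ hθ₀) htestV
  have hsol₀ : IsSolOn Q (x + θ₀ • v) h ψ₀ := ⟨hψ00, by simpa only [hQb] using hψ0der⟩
  have heq₀ : ∀ s ∈ Icc 0 h, flowSel Q (x + θ₀ • v) s = ψ₀ s := fun s hs => hS.flowSel_eq hsol₀ hs
  have hVder' : ∀ s ∈ Icc 0 h, HasDerivWithinAt V
      (Q (flowSel Q (x + θ₀ • v) s) (V s) + Q (V s) (flowSel Q (x + θ₀ • v) s)) (Icc 0 h) s := by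
    intro s hs
    rw [heq₀ s hs]
    simpa only [hQb] using hVder s hs
  refine ⟨V, hV0, hVder', hVbox, ?_⟩
  have hfam : ∀ θ ∈ Icc (0:ℝ) 1, IsSolOn Q (x + θ • v) h (fun s => flowSel Q (x + θ • v) s) ∧
      ∀ s ∈ Icc 0 h, flowSel Q (x + θ • v) s ∈ Icc lo hi := fun θ hθ =>
    let r := flowSel_of_highOrderEnclosure hS hh hJ (htest θ hθ)
    ⟨r.1, r.2.1⟩
  have hsub : Icc 0 t ⊆ Icc 0 h := Icc_subset_Icc_right ht.2
  refine hasDerivWithinAt_flow_initial Qb (ψ := fun θ s => flowSel Q (x + θ • v) s)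
    (R := max ‖lo‖ ‖hi‖) ht.1 hθ₀ (fun θ _ => flowSel_zero _) ?_ ?_ hV0 ?_
  · intro θ hθ s hs
    have h1 := (isSolOn_restrict (hfam θ hθ).1 ht).2 s hs
    simpa only [hQb] using h1
  · exact fun θ hθ s hs => norm_le_of_mem_Icc ((hfam θ hθ).2 s (hsub hs))
  · intro s hs
    have h1 := (hVder' s (hsub hs)).mono hsub
    simpa only [hQb] using h1

end Summit.NavierStokesRegularity.NavierStokesRegularity.Theorems.TaylorModelVector

end
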